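import Summits.QuantumFields.YangMills.Theorems.BalabanUVNodesPortS1FHInterface

/-!
# Bałaban UV nodes port — S₃ helper: s-DECOUPLED FAMILIES BY PIECES (the vocabulary of [II] (1.6)–(1.11) over an abstract decomposition)

Support file for ⟨stmt-QuantumFields-27930⟩ (`Lines/pta_residueW.lean`, stub S₃ `stub_FEpolymerActivitiesReg`), node A of the S₃ assembly (the F_W construction
(C-FW)⁺).  CARRIER-FREE finite algebra, the ONE vocabulary home (◆ CRIT-1 g41 cut of ◇ v29∕v27.4, nodeO STATUS 2026-08-31T22:01:13Z, T4): given ANY decomposition of an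
operator between Pi types into pieces `T_ω` with supports `supp ω` in an index set `σ` of cubes, print's s-insertion (p.3 L31–35 «we multiply the term in (1.6)
corresponding to ω by ∏ s(Δ_i)») is `pieceFamily supp T s := Σ_ω (∏_{Δ ∈ supp ω} s Δ) • T_ω`, and its rows are PROVED here by finite algebra: R1 `pieceFamily_one` (value
`Σ_ω T_ω` at `s = 1`, p.3 L35–36); (L1)(L2) `cubeDecoupled_pieceFamily` (the operator half of (1.8)–(1.10): entries vanish unless the argument cubes are joined inside
`supp s`, and depend on `s` only through the joint component — from CONNECTED supports that COVER both arguments); (L3)'s engine `pieceFamily_congr` (pieces agreeing off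
the zeros of `s` give the same operator at `s`; the U-locality row of a supplier is consumed through it); R4 `differentiable_pieceFamily` ∕ `norm_pieceFamily_le` ∕
`bounds_pieceFamily` ((1.11): analytic on `sPolydisc σ (e^{κ₁})`, bounded by `B₀e^{16κ₁}` from `Σ_ω ‖T_ω‖e^{κ₁|supp ω|} ≤ B₀e^{16κ₁}`).  §3 `CubeFaceAdj` = print's
COMMON-WALL adjacency on an index torus (p.4 L8–10).  The record-level letter (D-loc) ([13] (3.107)–(3.108) for [15]'s `H₁`) and its discharge wait for the fine-
configuration carrier (◆ C-1; ★★ def-Y (c5)) and are NOT in this file.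

HONEST: finite sums and products of continuous linear maps; no operator of [13]∕[15]∕[II] is constructed and no Bałaban estimate is proved; nothing at the record
is inhabited; COUNT-NEUTRAL (`--supports stmt-QuantumFields-27930 --as helper`); finite 𝕋⁴ at fixed ε — not continuum ∕ OS ∕ Clay; the Yang–Mills mass gap is NOT
proved.  Author ◇ lens-1 g18 (sketch `nodeO-cover/LENS1g18FWPieces.lean` 2d40f3ee §1–§3, `JoinedIn` renamed `SuppJoined` per ◆ (G)).
[cite: Balaban1988RG2Cluster, (1.6)–(1.7) p.3, p.3 L31–36, (1.8)–(1.10) p.4, (1.11) p.5]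
-/

noncomputable section

open scoped BigOperators

namespace Summit.QuantumFields.YangMills.Theorems.BalabanUVNodesPortS1.FWPieces

open Summit.QuantumFields.YangMills.Theorems.BalabanUVNodesPortS1.FHInterface (sPolydisc)

variable {σ ι₁ ι₂ : Type*}

/-! ## §1  Joined-inside-the-support, (L1)(L2), connected supports -/

/-- «`a` and `b` are joined INSIDE the support of `s`»: reflexive-transitive closure of adjacency through cubes where `s ≠ 0`, both endpoints in the support — the
walk-expansion reading of (1.6)∕(1.8): a term survives at `s` iff every cube its localisation domain meets has `s(Δ) ≠ 0`. [cite: Balaban1988RG2Cluster, (1.9)–(1.10) p.4] -/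
def SuppJoined (Adj : σ → σ → Prop) (s : σ → ℂ) (a b : σ) : Prop :=
  s a ≠ 0 ∧ Relation.ReflTransGen (fun x y => Adj x y ∧ s x ≠ 0 ∧ s y ≠ 0) a b

/-- **(L1)+(L2) for an s-family of linear maps between Pi types** — (L1) the `(p ← i)` entry of `Ts s` vanishes unless the cubes of `i` and `p` are joined inside
`supp s`; (L2) it depends on `s` only through `s` on that joint component: the OPERATOR half of (1.9)∕(1.10) in the s-variables («E(s∣_Y) depends on the variables in Y
and factorises over its connected components»). [cite: Balaban1988RG2Cluster, (1.8)–(1.10) p.4] -/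
def CubeDecoupled [DecidableEq ι₁] (Adj : σ → σ → Prop) (c₁ : ι₁ → σ) (c₂ : ι₂ → σ)
    (Ts : (σ → ℂ) → ((ι₁ → ℂ) →L[ℂ] (ι₂ → ℂ))) : Prop :=
  (∀ s i p, ¬ SuppJoined Adj s (c₁ i) (c₂ p) → Ts s (Pi.single i 1) p = 0) ∧
  (∀ s s' i p, (∀ Δ, SuppJoined Adj s (c₁ i) Δ ↔ SuppJoined Adj s' (c₁ i) Δ) → (∀ Δ, SuppJoined Adj s (c₁ i) Δ → s Δ = s' Δ) →
      Ts s (Pi.single i 1) p = Ts s' (Pi.single i 1) p)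

/-- A joined cube carries a non-zero `s`. [cite: Balaban1988RG2Cluster, (1.9) p.4 (face)] -/
theorem SuppJoined.ne_zero {Adj : σ → σ → Prop} {s : σ → ℂ} {a b : σ} (h : SuppJoined Adj s a b) : s b ≠ 0 := by
  obtain ⟨ha, hab⟩ := h
  induction hab with
  | refl => exact ha
  | tail _ hR _ => exact hR.2.2

/-- **Connected support** (print: the localization domain of a walk is a union of CONNECTED families of cubes, p.3 L10–12): any two cubes of `S`
are chained through adjacent cubes OF `S`. [cite: Balaban1988RG2Cluster, p.3 L10–12, p.4 L6–12] -/
def SuppConnected (Adj : σ → σ → Prop) (S : Finset σ) : Prop :=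
  ∀ a ∈ S, ∀ b ∈ S, Relation.ReflTransGen (fun x y => Adj x y ∧ x ∈ S ∧ y ∈ S) a b

/-- Inside a connected support on which `s` has no zero, every two cubes are joined in `supp s`. [cite: Balaban1988RG2Cluster, (1.9) p.4 (face)] -/
theorem suppJoined_of_conn {Adj : σ → σ → Prop} {S : Finset σ} (hS : SuppConnected Adj S) {s : σ → ℂ} (hs : ∀ Δ ∈ S, s Δ ≠ 0)
    {a b : σ} (ha : a ∈ S) (hb : b ∈ S) : SuppJoined Adj s a b := by
  refine ⟨hs a ha, ?_⟩
  have hab := hS a ha b hb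
  clear hb
  induction hab with
  | refl => exact Relation.ReflTransGen.refl
  | tail _ hxy ih => exact ih.tail ⟨hxy.1, hs _ hxy.2.1, hs _ hxy.2.2⟩

/-! ## §2  The piece family (print's construction p.3 L31–35, over an ABSTRACT decomposition) and its rows -/

section Pieces
variable {Ω : Type*} [Fintype Ω]

/-- **Print's s-insertion over a decomposition into pieces**: `Σ_ω (∏_{Δ ∈ supp ω} s Δ) • T_ω` («we multiply the term in (1.6) corresponding to ω by
∏ s(Δ_i)» over the σ₀-cubes meeting its localization domain). [cite: Balaban1988RG2Cluster, p.3 L31–35, (1.6) p.3] -/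
def pieceFamily (supp : Ω → Finset σ) (T : Ω → ((ι₁ → ℂ) →L[ℂ] (ι₂ → ℂ))) (s : σ → ℂ) : (ι₁ → ℂ) →L[ℂ] (ι₂ → ℂ) :=
  ∑ ω, (∏ Δ ∈ supp ω, s Δ) • T ω

/-- **«The pieces' supports contain the cubes of both arguments»** (print: `Δ(y), Δ(y′)` are localization cubes of the term, (1.7)). [cite: Balaban1988RG2Cluster, (1.7) p.3] -/
def Covers [DecidableEq ι₁] (c₁ : ι₁ → σ) (c₂ : ι₂ → σ) (supp : Ω → Finset σ) (T : Ω → ((ι₁ → ℂ) →L[ℂ] (ι₂ → ℂ))) : Prop :=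
  ∀ ω i p, T ω (Pi.single i 1) p ≠ 0 → c₁ i ∈ supp ω ∧ c₂ p ∈ supp ω

/-- R1: **at `s = 1` the family is the full operator `Σ_ω T_ω`** («They coincide with the original ones for s = 1», p.3 L35–36). [cite: Balaban1988RG2Cluster, p.3 L35–36] -/
theorem pieceFamily_one (supp : Ω → Finset σ) (T : Ω → ((ι₁ → ℂ) →L[ℂ] (ι₂ → ℂ))) : pieceFamily supp T 1 = ∑ ω, T ω := by
  simp [pieceFamily]

/-- Entries of the piece family. [cite: Balaban1988RG2Cluster, (1.6) p.3 (bookkeeping)] -/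
theorem pieceFamily_apply_single [DecidableEq ι₁] (supp : Ω → Finset σ) (T : Ω → ((ι₁ → ℂ) →L[ℂ] (ι₂ → ℂ))) (s : σ → ℂ) (i : ι₁) (p : ι₂) :
    pieceFamily supp T s (Pi.single i 1) p = ∑ ω, (∏ Δ ∈ supp ω, s Δ) * T ω (Pi.single i 1) p := by
  simp [pieceFamily, Finset.sum_apply]

omit [Fintype Ω] in
/-- A piece whose support meets a zero of `s` drops out. [cite: Balaban1988RG2Cluster, (1.9) p.4 (face)] -/
theorem prod_eq_zero_of_mem {supp : Ω → Finset σ} {s : σ → ℂ} {ω : Ω} {Δ : σ} (hΔ : Δ ∈ supp ω) (h0 : s Δ = 0) :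
    ∏ Δ' ∈ supp ω, s Δ' = 0 :=
  Finset.prod_eq_zero hΔ h0

/-- **(L1)+(L2) for the piece family** from CONNECTED supports that COVER the arguments: (L1) a surviving piece has `s ≠ 0` on its connected support, which
contains the cubes of `i` and `p`, so they are joined; (L2) if the component of the cube of `i` is the same for `s`, `s′` and `s = s′` on it, then piece by
piece either both products vanish or the support lies in the component and the products agree. [cite: Balaban1988RG2Cluster, (1.8)–(1.10) p.4] -/
theorem cubeDecoupled_pieceFamily [DecidableEq ι₁] {Adj : σ → σ → Prop} {c₁ : ι₁ → σ} {c₂ : ι₂ → σ} {supp : Ω → Finset σ}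
    {T : Ω → ((ι₁ → ℂ) →L[ℂ] (ι₂ → ℂ))} (hconn : ∀ ω, SuppConnected Adj (supp ω)) (hcov : Covers c₁ c₂ supp T) :
    CubeDecoupled Adj c₁ c₂ (pieceFamily supp T) := by
  constructor
  · intro s i p hnot
    rw [pieceFamily_apply_single]
    refine Finset.sum_eq_zero fun ω _ => ?_
    rcases eq_or_ne (T ω (Pi.single i 1) p) 0 with hT | hT
    · rw [hT, mul_zero]
    obtain ⟨hi, hp⟩ := hcov ω i p hT
    rcases em (∃ Δ ∈ supp ω, s Δ = 0) with ⟨Δ, hΔ, h0⟩ | hz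
    · rw [prod_eq_zero_of_mem hΔ h0, zero_mul]
    · have hz' : ∀ Δ ∈ supp ω, s Δ ≠ 0 := fun Δ hΔ h0 => hz ⟨Δ, hΔ, h0⟩
      exact absurd (suppJoined_of_conn (hconn ω) hz' hi hp) hnot
  · intro s s' i p hJ hEq
    rw [pieceFamily_apply_single, pieceFamily_apply_single]
    refine Finset.sum_congr rfl fun ω _ => ?_
    rcases eq_or_ne (T ω (Pi.single i 1) p) 0 with hT | hT
    · rw [hT, mul_zero, mul_zero]
    obtain ⟨hi, _hp⟩ := hcov ω i p hT
    congr 1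
    rcases em (∃ Δ ∈ supp ω, s Δ = 0) with ⟨Δ, hΔ, h0⟩ | hz
    · -- then `s′` has a zero on `supp ω` too: otherwise `Δ` would be joined to the cube of `i` under `s′`, hence under `s`, forcing `s Δ ≠ 0`
      rcases em (∃ Δ' ∈ supp ω, s' Δ' = 0) with ⟨Δ', hΔ', h0'⟩ | hz'
      · rw [prod_eq_zero_of_mem hΔ h0, prod_eq_zero_of_mem hΔ' h0']
      · have hne' : ∀ Δ' ∈ supp ω, s' Δ' ≠ 0 := fun Δ' hΔ' h => hz' ⟨Δ', hΔ', h⟩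
        exact absurd h0 ((hJ Δ).2 (suppJoined_of_conn (hconn ω) hne' hi hΔ)).ne_zero
    · have hne : ∀ Δ ∈ supp ω, s Δ ≠ 0 := fun Δ hΔ h => hz ⟨Δ, hΔ, h⟩
      exact Finset.prod_congr rfl fun Δ hΔ => hEq Δ (suppJoined_of_conn (hconn ω) hne hi hΔ)

/-- **(L3)'s ENGINE — locality in anything the pieces depend on**: if two decompositions have THE SAME PIECE `T_ω = T′_ω` whenever `supp ω` avoids the zeros
of `s`, they give the same operator at `s`.  (At the record: `T = T(U)`, `T′ = T(U′)` for backgrounds agreeing near `supp s`, and each piece U-local to its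
support — p.3 L14–16.) [cite: Balaban1988RG2Cluster, p.3 L14–16, p.4 L30–38] -/
theorem pieceFamily_congr (supp : Ω → Finset σ) {T T' : Ω → ((ι₁ → ℂ) →L[ℂ] (ι₂ → ℂ))} (s : σ → ℂ)
    (h : ∀ ω, (∀ Δ ∈ supp ω, s Δ ≠ 0) → T ω = T' ω) : pieceFamily supp T s = pieceFamily supp T' s := by
  unfold pieceFamily
  refine Finset.sum_congr rfl fun ω _ => ?_
  rcases em (∃ Δ ∈ supp ω, s Δ = 0) with ⟨Δ, hΔ, h0⟩ | hz
  · rw [prod_eq_zero_of_mem hΔ h0]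
    exact (zero_smul ℂ (T ω)).trans (zero_smul ℂ (T' ω)).symm
  · rw [h ω fun Δ hΔ h0 => hz ⟨Δ, hΔ, h0⟩]

open scoped Classical in
/-- A piece whose support is NOT inside `{s ≠ 0}` contributes nothing — so `pieceFamily … s` «depends on the pieces restricted to the support of s» (p.4 L30–38,
operator half). [cite: Balaban1988RG2Cluster, p.4 L30–38] -/
theorem pieceFamily_eq_sum_filter (supp : Ω → Finset σ) (T : Ω → ((ι₁ → ℂ) →L[ℂ] (ι₂ → ℂ))) (s : σ → ℂ) :
    pieceFamily supp T s = ∑ ω ∈ Finset.univ.filter (fun ω => ∀ Δ ∈ supp ω, s Δ ≠ 0), (∏ Δ ∈ supp ω, s Δ) • T ω := by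
  unfold pieceFamily
  rw [Finset.sum_filter]
  refine Finset.sum_congr rfl fun ω _ => ?_
  split_ifs with h
  · rfl
  · obtain ⟨Δ, hΔ, h0⟩ : ∃ Δ ∈ supp ω, s Δ = 0 := by
      by_contra hc
      exact h fun Δ hΔ h0 => hc ⟨Δ, hΔ, h0⟩
    rw [prod_eq_zero_of_mem hΔ h0]
    exact zero_smul ℂ (T ω)

variable [Fintype ι₁] [Fintype ι₂] [Fintype σ]

/-- Coordinate monomials are entire. [folklore] -/
theorem differentiable_finset_prod_apply (S : Finset σ) : Differentiable ℂ (fun s : σ → ℂ => ∏ Δ ∈ S, s Δ) := by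
  classical
  induction S using Finset.induction_on with
  | empty => simp
  | insert a S ha ih =>
    simp_rw [Finset.prod_insert ha]
    exact (differentiable_apply (𝕜 := ℂ) a).mul ih

/-- R4a: **the piece family is ENTIRE in `s`** (a polynomial with operator coefficients). [cite: Balaban1988RG2Cluster, (1.11) p.5] -/
theorem differentiable_pieceFamily (supp : Ω → Finset σ) (T : Ω → ((ι₁ → ℂ) →L[ℂ] (ι₂ → ℂ))) :
    Differentiable ℂ (pieceFamily supp T) := by
  show Differentiable ℂ (fun s : σ → ℂ => ∑ ω, (∏ Δ ∈ supp ω, s Δ) • T ω)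
  exact Differentiable.fun_sum fun ω _ => (differentiable_finset_prod_apply (supp ω)).smul (differentiable_const _)

omit [Fintype σ] in
/-- R4b: **the (1.11)-shape BOUND on the big polydisc from SUMMABILITY OF THE PIECES with weight `e^{κ₁|supp ω|}`** ((1.7)∕[13] (3.108): «the first two
factors in (1.7) are used to control the sum over ω, and they determine the constant B₀»). [cite: Balaban1988RG2Cluster, (1.7) p.3, (1.11) p.5] -/
theorem norm_pieceFamily_le (supp : Ω → Finset σ) (T : Ω → ((ι₁ → ℂ) →L[ℂ] (ι₂ → ℂ))) {κ₁ B : ℝ}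
    (hB : ∑ ω, ‖T ω‖ * Real.exp κ₁ ^ (supp ω).card ≤ B) {s : σ → ℂ} (hs : s ∈ sPolydisc σ (Real.exp κ₁)) :
    ‖pieceFamily supp T s‖ ≤ B := by
  have hs' : ∀ Δ, ‖s Δ‖ < Real.exp κ₁ := hs
  unfold pieceFamily
  calc ‖∑ ω, (∏ Δ ∈ supp ω, s Δ) • T ω‖ ≤ ∑ ω, ‖(∏ Δ ∈ supp ω, s Δ) • T ω‖ := norm_sum_le _ _
    _ ≤ ∑ ω, ‖T ω‖ * Real.exp κ₁ ^ (supp ω).card := by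
        refine Finset.sum_le_sum fun ω _ => ?_
        rw [norm_smul, Complex.norm_prod, mul_comm]
        refine mul_le_mul_of_nonneg_left ?_ (norm_nonneg _)
        calc ∏ Δ ∈ supp ω, ‖s Δ‖ ≤ ∏ _Δ ∈ supp ω, Real.exp κ₁ :=
              Finset.prod_le_prod (fun _ _ => norm_nonneg _) fun Δ _ => (hs' Δ).le
          _ = Real.exp κ₁ ^ (supp ω).card := Finset.prod_const _
    _ ≤ B := hB

/-- R4: **the (1.11) row** for the piece family, in print's and the interface's spelling (✓`DecoupledOps.Bounds`: `‖·‖ ≤ B₀·e^{16κ₁}` on `|s(Δ)| < e^{κ₁}`):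
from the weighted summability `Σ_ω ‖T_ω‖ e^{κ₁|supp ω|} ≤ B₀e^{16κ₁}` («the first two factors in (1.7) are used to control the sum over ω … the expression can be bounded by
e^{16κ₁}», p.3 L21–23, p.5 L13–19) the family is analytic on `sPolydisc σ (e^{κ₁})` and bounded by `B₀e^{16κ₁}` there. [cite: Balaban1988RG2Cluster, (1.11) p.5, (1.7) p.3] -/
theorem bounds_pieceFamily (supp : Ω → Finset σ) (T : Ω → ((ι₁ → ℂ) →L[ℂ] (ι₂ → ℂ))) {κ₁ B₀ : ℝ}
    (hB : ∑ ω, ‖T ω‖ * Real.exp κ₁ ^ (supp ω).card ≤ B₀ * Real.exp (16 * κ₁)) :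
    DifferentiableOn ℂ (pieceFamily supp T) (sPolydisc σ (Real.exp κ₁)) ∧
      ∀ s ∈ sPolydisc σ (Real.exp κ₁), ‖pieceFamily supp T s‖ ≤ B₀ * Real.exp (16 * κ₁) :=
  ⟨(differentiable_pieceFamily supp T).differentiableOn, fun _ hs => norm_pieceFamily_le supp T hB hs⟩

end Pieces

/-! ## §3  Print's adjacency: a common `(d−1)`-dimensional wall (p.4 L8–10) on an index torus -/

/-- **Common-wall adjacency of distinct cubes** on the index torus `ι → ZMod n` (neighbours differ by `±1` in exactly one coordinate direction): print's
connectivity for `Y(σ)` («boundaries of two successive terms in the sequence have a common d−1-dimensional wall», p.4 L8–10) — finer than ℓ^∞-contact,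
so (L1)(L2) typed with it are the stronger reading. [cite: Balaban1988RG2Cluster, p.4 L6–12] -/
def CubeFaceAdj {ι : Type*} [DecidableEq ι] {n : ℕ} (y y' : ι → ZMod n) : Prop :=
  y ≠ y' ∧ ∃ μ, y' = y + Pi.single μ 1 ∨ y = y' + Pi.single μ 1

/-- Common-wall adjacency is symmetric. [folklore] -/
theorem cubeFaceAdj_symm {ι : Type*} [DecidableEq ι] {n : ℕ} {y y' : ι → ZMod n} (h : CubeFaceAdj y y') : CubeFaceAdj y' y := by
  obtain ⟨hne, μ, hμ⟩ := h
  exact ⟨fun e => hne e.symm, μ, hμ.symm⟩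

end Summit.QuantumFields.YangMills.Theorems.BalabanUVNodesPortS1.FWPieces

end
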